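import Literature.Probability.Percolation.KSTPeriodicWeak
import HarnessLib

/-!
# KST-type RSW for periodic measures: the standard gluing of rectangle crossings

Topic `Literature/Probability/Percolation`. The "standard gluing construction" of
[KohlerSchindlerTassion2023, §3, proof of Lemma 1, second case and (iii)] for `kℤ² ⋊ D₄`-periodic
positively associated measures (`Admissible k t μ`, `KSTPeriodicDefs.lean`):

* pathwise: two left–right crossings of horizontally overlapping rectangles of the same height
  together with a top–bottom crossing of the overlap give a left–right crossing of the union
  (`lrRect_glue`, from "a left–right and a top–bottom crossing meet",
  `exists_mem_support_of_crossing`);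
* in probability (FKG): `μ(LR₁) μ(LR₂) μ(TB) ≤ μ(LR of the union)` (`real_lrRect_glue`);
* iterating along translates by a vector of `kℤ²`: for a rectangle `[L, R] × [B, T]` with
  `L + ke ≤ B ≤ T ≤ R`, `μ(lrRect L R B T)^(2j+1) ≤ μ(lrRect L (R + jke) B T)`
  (`pow_le_real_lrRect_extend`), and the passage from a long rectangle containing a translate of
  `R_t(ρ n, n)` to `𝓒_t(ρ n, n)` (`real_lrRect_le_real_crossing`).

## References

* [KohlerSchindlerTassion2023] L. Köhler-Schindler, V. Tassion, *Crossing probabilities for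
  planar percolation*, Duke Math. J. 172 (2023) 809–838, §3 (proof of Lemma 1).
* [GrimmettPercolation1999] G. Grimmett, *Percolation* (1999), §11.7 (RSW gluing).
-/

namespace Literature.Probability.Percolation

open _root_.MeasureTheory LatticeModels

noncomputable section

namespace KSTPeriodic

/-! ### Narrowing an open connection to a left–right crossing -/

/-- For a lattice configuration, an open connection inside a horizontal strip `{c ≤ x₁ ≤ d}` from a
point left of the column `a` to a point right of the column `b ≥ a` contains a left–right crossing
of `[a, b] × [c, d]` (first visit to the column `b`, then last visit to the column `a` before it).
[folklore] -/
theorem lrRect_of_openConnIn {ω : BondConfig (Site 2)} (hω : ω ⊆ (zdGraph 2).edgeSet)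
    {S : Set (Site 2)} {x y : Site 2} {a b c d : ℤ} (hx : x 0 ≤ a) (hab : a ≤ b) (hy : b ≤ y 0)
    (hS : S ⊆ {z | c ≤ z 1 ∧ z 1 ≤ d}) (h : ω ∈ openConnIn S x y) : ω ∈ lrRect a b c d := by
  -- first visit to the column `b`
  obtain ⟨z, hz0, hxz⟩ := exists_openConnIn_column hω b (hx.trans hab) hy h
  -- last visit to the column `a` before it
  rw [openConnIn_comm] at hxz
  obtain ⟨z', hz'0, hzz'⟩ := exists_openConnIn_column_ge hω a (by omega) hx hxz
  rw [openConnIn_comm] at hzz'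
  have hsub : (S ∩ {v : Site 2 | v 0 ≤ b}) ∩ {v : Site 2 | a ≤ v 0} ⊆ rect a b c d := by
    rintro v ⟨⟨hv, hv1⟩, hv2⟩
    have := hS hv
    simp only [mem_rect, Set.mem_setOf_eq] at hv1 hv2 this ⊢
    omega
  obtain ⟨hz'S, hzS, _⟩ := id hzz'
  exact ⟨z', ⟨hsub hz'S, hz'0⟩, z, ⟨hsub hzS, hz0⟩, openConnIn_mono hsub z' z hzz'⟩

/-! ### Pathwise gluing -/

/-- **Standard gluing, pathwise.** For a lattice configuration: left–right crossings of
`[a₁, b₁] × [c, d]` and of `[a₂, b₂] × [c, d]` with `a₁ ≤ a₂`, `b₁ ≤ b₂`, together with a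
top–bottom crossing of the overlap `[a₂, b₁] × [c, d]`, give a left–right crossing of
`[a₁, b₂] × [c, d]` (each left–right crossing meets the top–bottom one).
[cite: KohlerSchindlerTassion2023, §3, proof of Lemma 1 (second case)] -/
theorem lrRect_glue {ω : BondConfig (Site 2)} (hω : ω ⊆ (zdGraph 2).edgeSet)
    {a₁ a₂ b₁ b₂ c d : ℤ} (h₁ : a₁ ≤ a₂) (h₃ : b₁ ≤ b₂)
    (hA : ω ∈ lrRect a₁ b₁ c d) (hB : ω ∈ lrRect a₂ b₂ c d) (hT : ω ∈ tbRect a₂ b₁ c d) :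
    ω ∈ lrRect a₁ b₂ c d := by
  classical
  obtain ⟨x, ⟨hxR, hx0⟩, y, ⟨-, hy0⟩, hxy⟩ := hA
  obtain ⟨x', ⟨-, hx'0⟩, y', ⟨hy'R, hy'0⟩, hx'y'⟩ := hB
  obtain ⟨u, ⟨-, hu1⟩, v, ⟨-, hv1⟩, huv⟩ := hT
  obtain ⟨P, hPS, hPω⟩ := exists_walk_of_mem_openConnIn hω hxy
  obtain ⟨P', hP'S, hP'ω⟩ := exists_walk_of_mem_openConnIn hω hx'y'
  obtain ⟨Q, hQS, hQω⟩ := exists_walk_of_mem_openConnIn hω huv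
  -- the first crossing meets the vertical one
  obtain ⟨z₁, hz₁P, hz₁Q⟩ := exists_mem_support_of_crossing (L := a₁) (R := b₁) (B := c) (T := d) P Q
    (fun z hz => by have := hPS z hz; simp only [mem_rect] at this; omega)
    (fun z hz => by have := hQS z hz; simp only [mem_rect] at this; omega) hx0 hy0 hu1 hv1
  -- so does the second one
  obtain ⟨z₂, hz₂P, hz₂Q⟩ := exists_mem_support_of_crossing (L := a₂) (R := b₂) (B := c) (T := d) P' Q
    (fun z hz => by have := hP'S z hz; simp only [mem_rect] at this; omega)
    (fun z hz => by have := hQS z hz; simp only [mem_rect] at this; omega) hx'0 hy'0 hu1 hv1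
  have hbig₁ : rect a₁ b₁ c d ⊆ rect a₁ b₂ c d := rect_mono le_rfl h₃ le_rfl le_rfl
  have hbig₂ : rect a₂ b₂ c d ⊆ rect a₁ b₂ c d := rect_mono h₁ le_rfl le_rfl le_rfl
  have hbigT : rect a₂ b₁ c d ⊆ rect a₁ b₂ c d := rect_mono h₁ h₃ le_rfl le_rfl
  -- `x ↔ z₁`
  have e₁ : ω ∈ openConnIn (rect a₁ b₂ c d) x z₁ :=
    openConnIn_mono hbig₁ _ _ (mem_openConnIn_of_mem_support P hPS hPω hz₁P)
  -- `z₁ ↔ z₂` along the vertical crossing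
  have e₂ : ω ∈ openConnIn (rect a₁ b₂ c d) z₁ z₂ := by
    have h1 := mem_openConnIn_of_mem_support Q hQS hQω hz₁Q
    have h2 := mem_openConnIn_of_mem_support Q hQS hQω hz₂Q
    rw [openConnIn_comm] at h1
    exact openConnIn_mono hbigT _ _ (PlanarDuality.openConnIn_trans h1 h2)
  -- `z₂ ↔ y'` along the second crossing
  have e₃ : ω ∈ openConnIn (rect a₁ b₂ c d) z₂ y' := by
    have h1 := mem_openConnIn_of_mem_support P' hP'S hP'ω hz₂P
    rw [openConnIn_comm] at h1
    exact openConnIn_mono hbig₂ _ _ (PlanarDuality.openConnIn_trans h1 hx'y')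
  exact ⟨x, ⟨hbig₁ hxR, hx0⟩, y', ⟨hbig₂ hy'R, hy'0⟩,
    PlanarDuality.openConnIn_trans e₁ (PlanarDuality.openConnIn_trans e₂ e₃)⟩

/-! ### Gluing in probability -/

variable {k t : ℕ} {μ : Measure (BondConfig (Site 2))}

/-- **Standard gluing, FKG form**: `μ(LR[a₁,b₁]) · μ(LR[a₂,b₂]) · μ(TB[a₂,b₁]) ≤ μ(LR[a₁,b₂])` for
rectangles of a common height, `a₁ ≤ a₂`, `b₁ ≤ b₂`, and a positively associated measure carried by
lattice configurations. [cite: KohlerSchindlerTassion2023, §3, proof of Lemma 1 (second case)] -/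
theorem real_lrRect_glue [IsProbabilityMeasure μ] (hμ : Admissible k t μ) (hL : LatticeCarried μ)
    {a₁ a₂ b₁ b₂ c d : ℤ} (h₁ : a₁ ≤ a₂) (h₃ : b₁ ≤ b₂) :
    μ.real (lrRect a₁ b₁ c d) * μ.real (lrRect a₂ b₂ c d) * μ.real (tbRect a₂ b₁ c d) ≤
      μ.real (lrRect a₁ b₂ c d) := by
  have hAB : μ.real (lrRect a₁ b₁ c d) * μ.real (lrRect a₂ b₂ c d) ≤
      μ.real (lrRect a₁ b₁ c d ∩ lrRect a₂ b₂ c d) :=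
    mul_le_real_inter hμ (isUpperSet_lrRect _ _ _ _) (isUpperSet_lrRect _ _ _ _)
      (measurableSet_lrRect _ _ _ _) (measurableSet_lrRect _ _ _ _)
  have hABT : μ.real (lrRect a₁ b₁ c d ∩ lrRect a₂ b₂ c d) * μ.real (tbRect a₂ b₁ c d) ≤
      μ.real (lrRect a₁ b₁ c d ∩ lrRect a₂ b₂ c d ∩ tbRect a₂ b₁ c d) :=
    mul_le_real_inter hμ ((isUpperSet_lrRect _ _ _ _).inter (isUpperSet_lrRect _ _ _ _))
      (isUpperSet_tbRect _ _ _ _) ((measurableSet_lrRect _ _ _ _).inter (measurableSet_lrRect _ _ _ _))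
      (measurableSet_tbRect _ _ _ _)
  have hincl : μ.real (lrRect a₁ b₁ c d ∩ lrRect a₂ b₂ c d ∩ tbRect a₂ b₁ c d) ≤
      μ.real (lrRect a₁ b₂ c d) := by
    refine ENNReal.toReal_mono (measure_ne_top _ _) (measure_mono_ae ?_)
    filter_upwards [hL] with ω hω h using lrRect_glue hω h₁ h₃ h.1.1 h.1.2 h.2
  calc μ.real (lrRect a₁ b₁ c d) * μ.real (lrRect a₂ b₂ c d) * μ.real (tbRect a₂ b₁ c d)
      ≤ μ.real (lrRect a₁ b₁ c d ∩ lrRect a₂ b₂ c d) * μ.real (tbRect a₂ b₁ c d) :=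
        mul_le_mul_of_nonneg_right hAB measureReal_nonneg
    _ ≤ _ := hABT
    _ ≤ _ := hincl

/-- Probability form of the narrowing `lrRect_subset_lrRect` for a measure carried by lattice
configurations: narrower and taller rectangles are easier to cross.
[cite: KohlerSchindlerTassion2023, §5.2 (by inclusion of events)] -/
theorem real_lrRect_mono [IsFiniteMeasure μ] (hL : LatticeCarried μ) {a b c d a' b' c' d' : ℤ}
    (ha : a ≤ a') (hab : a' ≤ b') (hb : b' ≤ b) (hc : c' ≤ c) (hd : d ≤ d') :
    μ.real (lrRect a b c d) ≤ μ.real (lrRect a' b' c' d') := by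
  refine ENNReal.toReal_mono (measure_ne_top _ _) (measure_mono_ae ?_)
  filter_upwards [hL] with ω hω h using lrRect_subset_lrRect hω ha hab hb hc hd h

/-- **Iterated gluing along `kℤ²`-translates.** For a rectangle `[L, R] × [B, T]` with
`L + ke ≤ B ≤ T ≤ R` (so that the transposed overlaps contain vertical translates of the
rectangle), `μ(lrRect L R B T)^(2j+1) ≤ μ(lrRect L (R + jke) B T)`: each step glues one more
translate by `(ke, 0)` at the cost of two factors (the translate and the top–bottom crossing of
the overlap, which is at least as likely by transposition, translation and inclusion).
[cite: KohlerSchindlerTassion2023, §3, proof of Lemma 1 (second case and (iii))] -/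
theorem pow_le_real_lrRect_extend [IsProbabilityMeasure μ] (hμ : Admissible k t μ) (hL : LatticeCarried μ)
    {L R B T : ℤ} (e : ℕ) (hB : L + k * e ≤ B) (hBT : B ≤ T) (hT : T ≤ R) (j : ℕ) :
    μ.real (lrRect L R B T) ^ (2 * j + 1) ≤ μ.real (lrRect L (R + j * (k * e)) B T) := by
  induction j with
  | zero => simp
  | succ j ih =>
    have hke : (0 : ℤ) ≤ k * e := by positivity
    -- the translate by `((j+1)ke, 0)`
    have hD : μ.real (lrRect (L + (j + 1 : ℕ) * (k * e)) (R + (j + 1 : ℕ) * (k * e)) B T) =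
        μ.real (lrRect L R B T) := by
      have h := real_lrRect_shift hμ ![(j + 1 : ℕ) * e, 0] L R B T
      simp only [Matrix.cons_val_zero, Matrix.cons_val_one, mul_zero, add_zero] at h
      rw [← h]; congr 2 <;> push_cast <;> ring
    -- the top–bottom crossing of the overlap
    have hTB : μ.real (lrRect L R B T) ≤
        μ.real (tbRect (L + (j + 1 : ℕ) * (k * e)) (R + j * (k * e)) B T) := by
      rw [real_tbRect_eq_real_lrRect hμ]
      have h := real_lrRect_shift hμ ![0, j * e] L R B T
      simp only [Matrix.cons_val_zero, Matrix.cons_val_one, mul_zero, add_zero] at h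
      rw [← h]
      refine real_lrRect_mono hL ?_ hBT hT ?_ ?_
      · omega
      · push_cast; nlinarith
      · nlinarith
    have hglue := real_lrRect_glue hμ hL (a₁ := L) (a₂ := L + (j + 1 : ℕ) * (k * e)) (b₁ := R + j * (k * e))
      (b₂ := R + (j + 1 : ℕ) * (k * e)) (c := B) (d := T) (by push_cast; nlinarith) (by push_cast; nlinarith)
    rw [hD] at hglue
    have h0 : 0 ≤ μ.real (lrRect L R B T) := measureReal_nonneg
    calc μ.real (lrRect L R B T) ^ (2 * (j + 1) + 1)
        = μ.real (lrRect L R B T) ^ (2 * j + 1) * μ.real (lrRect L R B T) * μ.real (lrRect L R B T) := by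
          ring
      _ ≤ μ.real (lrRect L (R + j * (k * e)) B T) * μ.real (lrRect L R B T) *
            μ.real (tbRect (L + (j + 1 : ℕ) * (k * e)) (R + j * (k * e)) B T) :=
          mul_le_mul (mul_le_mul_of_nonneg_right ih h0) hTB h0 (mul_nonneg measureReal_nonneg h0)
      _ ≤ μ.real (lrRect L (R + (j + 1 : ℕ) * (k * e)) B T) := hglue

/-- From a long rectangle to `𝓒_t(ρ n, n)`: if a translate by a vector of `kℤ²` of
`[a, c] × [-n - t, n]` contains the columns of `R_t(m, n)`, then
`μ(lrRect a c (-n-t) n) ≤ μ(𝓒_t(m, n))` (translation invariance and inclusion of events).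
[cite: KohlerSchindlerTassion2023, §3, proof of Lemma 1] -/
theorem real_lrRect_le_real_crossing [IsProbabilityMeasure μ] (hμ : Admissible k t μ) (hL : LatticeCarried μ)
    {a c : ℤ} {m n : ℕ} (w : ℤ) (ha : a + k * w ≤ -(m : ℤ) - t) (hc : (m : ℤ) ≤ c + k * w) :
    μ.real (lrRect a c (-(n : ℤ) - t) n) ≤ μ.real (crossing t m n) := by
  have h := real_lrRect_shift hμ ![w, 0] a c (-(n : ℤ) - t) n
  simp only [Matrix.cons_val_zero, Matrix.cons_val_one, mul_zero, add_zero] at h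
  rw [← h, crossing]
  exact real_lrRect_mono hL ha (by omega) hc le_rfl le_rfl

end KSTPeriodic

end

end Literature.Probability.Percolation
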